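import Literature.AnabelianGeometry.SemiGraphs.PSCThm16InputsSmoothProperGenuine
import Literature.GroupTheory.CombinatorialGroupTheory.PuncturedSurfaceGroupCusps
import HarnessLib

/-!
# [CombGC] Rmk. 1.1.6 at genuine smooth-CURVE data: the compactification is a genuine smooth (proper) curve

Mochizuki, *A combinatorial version of the Grothendieck conjecture* [CombGC], Tohoku Math. J. **59**
(2007), §1, Remark 1.1.6 p. 8: "Suppose that `G` is sturdy. Then observe that the quotient
`Π_G ↠ Π^cpt_G` determines a new semi-graph of anabelioids `G'` of PSC-type … the compactification of
`G` … `Π^cpt_G ⥲ Π_{G'}`"; Def. 1.1 (i)–(ii) p. 6. [cite: MochizukiCombGC2007, Rmk 1.1.6 p.8]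
[cite: MochizukiCombGC2007, Def 1.1(ii) p.6]

PROOF-ONLY file (abc-iut cell, layer L3, L-F sub-cell [SemiAnbd]+[CombGC] pack C, row
«COMPACTIFY@SC-GENUINE», seat abc-iut-w5-d174 gen 5; the smooth-CURVE twin of abc-iut-w5-d183's
`compactifyAlong_smoothProperGenuine` in `PSCThm16InputsSmoothProperGenuine.lean`).  The origin-level
closure statement `CompactifyOfPSCTypeHolds Ω` (`PSCCompactification.lean`) is one of the thirteen named
inputs of the [CombGC] Thm. 1.6 capstone (`thm16_holds_of_inputs`); at abc-iut-w5-d195's covering-closed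
pro-`ℓ` GENUINE smooth-curve origin (profinite `Π`, no nodes, one vertex with `Π_v = Π`, `Σ = {ℓ}`, a
pro-`ℓ` completion `ι : Γ_{g,r} → Π` of a hyperbolic punctured surface group, `genus(v) = g`, cusp groups
conjugates `δ_c · closure ι⟨c_{e c}⟩ · δ_c⁻¹`) it was one of the inputs still owed
(abc-iut-w5-d183 gen 4 HANDOFF: "compactify needs the genuine SP datum of the compactified curve:
`ῑ : S_g → Q` from `Γ_{g,r} → S_g`, a real step").  This file supplies it:

* `PuncturedSurfaceGroup.nonempty_mulEquiv_quotient_cusps` — the group theory: killing the cusps of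
  the punctured surface group gives the closed surface group in its `r = 0` presentation,
  `Γ_{g,0} ≃* Γ_{g,r} ⧸ ⟨⟨c_1, …, c_r⟩⟩` (two presentations, two-sided inverse on generators; the
  relator `[a_1,b_1]⋯[a_g,b_g]` of `Γ_{g,0}` dies in the quotient because `∏[a_i,b_i] = (c_1⋯c_r)⁻¹`);
* (private plumbing) a Hausdorff quotient of a profinite group is profinite and `Π/ker f ≃ₜ* Q`;
* `cptKer_eq_unrKer_of_isEmpty` — with no nodes `Ker(Π ↠ Π^cpt) = Ker(Π ↠ Π^unr)`
  (`= closure ι⟨⟨c_j⟩⟩` by abc-iut-w5-d195's `unrKer_eq_closure_map_of_smoothCurve'`);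
* `compactifyAlong_smoothCurveGenuine` — **Rmk. 1.1.6 at a genuine smooth-curve datum**: for `G` as
  above, STURDY (`g ≥ 2`), and a presentation `f : Π ↠ Q` of `Π^cpt_G` (`Q` Hausdorff, `ker f = cptKer`),
  the compactified datum `G.compactifyAlong f` is genuine smooth-curve of type `(g, 0)`: `Q` is
  profinite, one vertex with `Π'_v = Q`, no nodes, no cusps, and
  `ῑ : Γ_{g,0} ≅ Γ_{g,r}/⟨⟨c_j⟩⟩ → Π/closure ι⟨⟨c_j⟩⟩ = Π/ker f ≅ Q` is a pro-`Σ` completion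
  (`IsProSigmaCompletion.quotientMap_of_coe_eq_closure`, transported along the topological
  isomorphism `Π/ker f ≃ₜ* Q` of compact-to-Hausdorff and along the group isomorphism above);
* `compactifyOfPSCTypeHolds_of_smoothCurveGenuine` — **`CompactifyOfPSCTypeHolds Ω`** for EVERY origin
  `Ω` whose membership predicate is (both ways) the pro-`ℓ` genuine smooth-curve shape — in particular
  abc-iut-w5-d195's `Ω` of `exists_smoothCurveGenuineProLOrigin_holds` (its `let Ω` is this predicate
  verbatim, so `hout`/`hin` are the identity there).

0 definitions; plain (pro)finite group theory over tree theorems; consistency / non-vacuity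
infrastructure for genuine one-component data with cusps; not the printed theorems for all pointed
stable curves; nothing here takes a side on [IUTchIII] Cor. 3.12.
-/

noncomputable section

/-! ### Group theory: killing the cusps of `Γ_{g,r}` gives `Γ_{g,0}` -/

namespace Literature.GroupTheory.CombinatorialGroupTheory.PuncturedSurfaceGroup

variable {g r : ℕ}

/-- In `Γ_{g,r}` the product of the handle commutators is the inverse of the product of the cusp
generators: `[a_1,b_1]⋯[a_g,b_g] = (c_1⋯c_r)⁻¹` (the defining relator).
[cite: MochizukiSemiAnbd2006, Ex. 2.10 p.31] -/
theorem prod_comm_eq_inv_prod_c :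
    ((List.finRange g).map fun i =>
        (a i : PuncturedSurfaceGroup g r) * b i * (a i)⁻¹ * (b i)⁻¹).prod =
      (((List.finRange r).map fun j => (c j : PuncturedSurfaceGroup g r)).prod)⁻¹ := by
  have hlift : FreeGroup.lift (PresentedGroup.of (rels := ({relator g r} : Set _))) =
      PresentedGroup.mk ({relator g r} : Set (FreeGroup (puncturedSurfaceGen g r))) :=
    FreeGroup.ext_hom _ _ fun x => by rw [FreeGroup.lift_apply_of]; rfl
  have h1 : FreeGroup.lift (PresentedGroup.of (rels := ({relator g r} : Set _))) (relator g r) = 1 := by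
    rw [hlift]
    exact PresentedGroup.one_of_mem (Set.mem_singleton _)
  rw [lift_relator] at h1
  exact eq_inv_of_mul_eq_one_left h1

/-- In the closed surface group `Γ_{g,0}` (presentation with no cusp generators) the product of the
handle commutators is trivial. [cite: MochizukiSemiAnbd2006, Ex. 2.10 p.31] -/
theorem prod_comm_eq_one_zero :
    ((List.finRange g).map fun i =>
        (a i : PuncturedSurfaceGroup g 0) * b i * (a i)⁻¹ * (b i)⁻¹).prod = 1 := by
  rw [prod_comm_eq_inv_prod_c, List.finRange_zero, List.map_nil, List.prod_nil, inv_one]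

/-- **`Γ_{g,0} ≅ Γ_{g,r} ⧸ ⟨⟨c_1, …, c_r⟩⟩`**: killing the cusp inertia groups of the punctured surface
group yields the closed surface group of the same genus in its `r = 0` presentation (`a_i, b_i ↦
ā_i, b̄_i`; well defined because `∏[a_i,b_i] = (∏ c_j)⁻¹` dies; inverse `a_i, b_i ↦ a_i, b_i`,
`c_j ↦ 1`) — the fundamental group of the compactified curve. [cite: MochizukiCombGC2007, Rmk 1.1.6 p.8] -/
theorem nonempty_mulEquiv_quotient_cusps (g r : ℕ) :
    Nonempty (PuncturedSurfaceGroup g 0 ≃*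
      PuncturedSurfaceGroup g r ⧸ Subgroup.normalClosure
        (⋃ j, (cuspInertia (g := g) (r := r) j : Set (PuncturedSurfaceGroup g r)))) := by
  classical
  set N : Subgroup (PuncturedSurfaceGroup g r) :=
    Subgroup.normalClosure (⋃ j, (cuspInertia (g := g) (r := r) j : Set (PuncturedSurfaceGroup g r)))
    with hN
  have hcN : ∀ j, (c j : PuncturedSurfaceGroup g r) ∈ N := fun j =>
    Subgroup.subset_normalClosure (Set.mem_iUnion.mpr ⟨j, Subgroup.mem_zpowers _⟩)
  -- `φ : Γ_{g,r} → Γ_{g,0}`, `a_i, b_i ↦ a_i, b_i`, `c_j ↦ 1`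
  let fφ : puncturedSurfaceGen g r → PuncturedSurfaceGroup g 0 :=
    Sum.elim (fun ib => PresentedGroup.of (Sum.inl ib)) fun _ => 1
  have hφ : ∀ w ∈ ({relator g r} : Set (FreeGroup (puncturedSurfaceGen g r))),
      FreeGroup.lift fφ w = 1 := by
    intro w hw
    rw [Set.mem_singleton_iff] at hw
    rw [hw, lift_relator]
    have h2 : ((List.finRange r).map fun j => fφ (Sum.inr j)).prod = 1 :=
      List.prod_eq_one fun y hy => by
        obtain ⟨j, -, rfl⟩ := List.mem_map.mp hy
        rfl
    rw [h2, mul_one]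
    exact prod_comm_eq_one_zero
  let φ : PuncturedSurfaceGroup g r →* PuncturedSurfaceGroup g 0 := PresentedGroup.toGroup hφ
  have hφa : ∀ ib, φ (PresentedGroup.of (Sum.inl ib)) = PresentedGroup.of (Sum.inl ib) := fun ib =>
    PresentedGroup.toGroup.of hφ
  have hφc : ∀ j, φ (c j) = 1 := fun j => PresentedGroup.toGroup.of hφ
  have hNφ : N ≤ φ.ker := by
    refine Subgroup.normalClosure_le_normal ?_
    intro x hx
    obtain ⟨j, hj⟩ := Set.mem_iUnion.mp hx
    obtain ⟨k, rfl⟩ := Subgroup.mem_zpowers_iff.mp hj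
    rw [SetLike.mem_coe, MonoidHom.mem_ker, map_zpow, hφc, one_zpow]
  let φbar : PuncturedSurfaceGroup g r ⧸ N →* PuncturedSurfaceGroup g 0 := QuotientGroup.lift N φ hNφ
  -- `ψ : Γ_{g,0} → Γ_{g,r} / N`, `a_i, b_i ↦ ā_i, b̄_i`
  let fψ : puncturedSurfaceGen g 0 → PuncturedSurfaceGroup g r ⧸ N :=
    Sum.elim (fun ib => QuotientGroup.mk (PresentedGroup.of (Sum.inl ib))) fun j => j.elim0
  have hψ : ∀ w ∈ ({relator g 0} : Set (FreeGroup (puncturedSurfaceGen g 0))),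
      FreeGroup.lift fψ w = 1 := by
    intro w hw
    rw [Set.mem_singleton_iff] at hw
    rw [hw, lift_relator, List.finRange_zero, List.map_nil, List.prod_nil, mul_one]
    have hmap : ((List.finRange g).map fun i =>
        fψ (Sum.inl (i, false)) * fψ (Sum.inl (i, true)) * (fψ (Sum.inl (i, false)))⁻¹ *
          (fψ (Sum.inl (i, true)))⁻¹).prod =
        QuotientGroup.mk' N (((List.finRange g).map fun i =>
          (a i : PuncturedSurfaceGroup g r) * b i * (a i)⁻¹ * (b i)⁻¹).prod) := by
      rw [map_list_prod, List.map_map]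
      rfl
    have hprod : ((List.finRange r).map fun j => (c j : PuncturedSurfaceGroup g r)).prod ∈ N := by
      refine N.list_prod_mem ?_
      intro y hy
      obtain ⟨j, -, rfl⟩ := List.mem_map.mp hy
      exact hcN j
    rw [hmap, prod_comm_eq_inv_prod_c, map_inv, inv_eq_one, QuotientGroup.mk'_apply,
      QuotientGroup.eq_one_iff]
    exact hprod
  let ψ : PuncturedSurfaceGroup g 0 →* PuncturedSurfaceGroup g r ⧸ N := PresentedGroup.toGroup hψ
  have hψa : ∀ ib, ψ (PresentedGroup.of (Sum.inl ib)) = QuotientGroup.mk (PresentedGroup.of (Sum.inl ib)) :=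
    fun ib => PresentedGroup.toGroup.of hψ
  -- two-sided inverse
  have h1 : φbar.comp ψ = MonoidHom.id _ := by
    refine PresentedGroup.ext fun x => ?_
    rcases x with ib | j
    · rw [MonoidHom.comp_apply, hψa, MonoidHom.id_apply]
      exact (QuotientGroup.lift_mk N hNφ _).trans (hφa ib)
    · exact j.elim0
  have h2 : ψ.comp φbar = MonoidHom.id _ := by
    refine QuotientGroup.monoidHom_ext N (PresentedGroup.ext fun x => ?_)
    rw [MonoidHom.comp_apply, MonoidHom.comp_apply, MonoidHom.comp_apply, MonoidHom.id_apply,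
      QuotientGroup.coe_mk', QuotientGroup.lift_mk]
    rcases x with ib | j
    · rw [hφa, hψa]
    · change ψ (φ (c j)) = QuotientGroup.mk (c j)
      rw [hφc, map_one, eq_comm, QuotientGroup.eq_one_iff]
      exact hcN j
  exact ⟨MonoidHom.toMulEquiv ψ φbar h1 h2⟩

end Literature.GroupTheory.CombinatorialGroupTheory.PuncturedSurfaceGroup

namespace Literature.AnabelianGeometry.SemiGraphs

namespace PSCDatum

open scoped Pointwise
open Literature.GroupTheory.CombinatorialGroupTheory
open Literature.GroupTheory.CombinatorialGroupTheory.PuncturedSurfaceGroup (cuspInertia IsHyperbolicType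
  nonempty_mulEquiv_quotient_cusps)
open SemiGraphOfAnabelioids (IsProSigmaCompletion)

universe u

variable {P : Type u} [Group P] [TopologicalSpace P] [IsTopologicalGroup P]

/-! ### Plumbing: Hausdorff quotients of profinite groups -/

/-- For a continuous surjective homomorphism `f : Π ↠ Q` from a compact totally disconnected group onto
a Hausdorff group: `Q` is compact and totally disconnected, and the induced `Π / ker f → Q` is a
topological isomorphism. [folklore] -/
private theorem exists_quotientKer_continuousMulEquiv [CompactSpace P] [TotallyDisconnectedSpace P]
    {Q : Type u} [Group Q] [TopologicalSpace Q] [IsTopologicalGroup Q] [T2Space Q]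
    (f : P →* Q) (hf : Continuous f) (hs : Function.Surjective f) :
    CompactSpace Q ∧ TotallyDisconnectedSpace Q ∧
      ∃ e : (P ⧸ f.ker) ≃ₜ* Q, ∀ x : P, e (QuotientGroup.mk x) = f x := by
  haveI : CompactSpace Q := ⟨by rw [← hs.range_eq]; exact isCompact_range hf⟩
  have hK : IsClosed (f.ker : Set P) := by
    have : (f.ker : Set P) = f ⁻¹' {1} := by
      ext x
      simp only [SetLike.mem_coe, MonoidHom.mem_ker, Set.mem_preimage, Set.mem_singleton_iff]
    rw [this]
    exact isClosed_singleton.preimage hf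
  haveI := AbsoluteAnabelian.QuotientGroup.totallyDisconnectedSpace_of_isClosed f.ker hK
  let φ : P ⧸ f.ker ≃* Q := QuotientGroup.quotientKerEquivOfSurjective f hs
  have hφ : Continuous φ := by
    refine (QuotientGroup.isQuotientMap_mk f.ker).continuous_iff.mpr ?_
    have : (φ : P ⧸ f.ker → Q) ∘ QuotientGroup.mk = f := by
      funext x
      rfl
    rw [this]
    exact hf
  let h : (P ⧸ f.ker) ≃ₜ Q := Continuous.homeoOfEquivCompactToT2 (f := φ.toEquiv) hφ
  refine ⟨inferInstance, h.totallyDisconnectedSpace,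
    ⟨{ φ with continuous_toFun := hφ, continuous_invFun := h.symm.continuous }, fun x => rfl⟩⟩

/-! ### Rmk. 1.1.6 at a genuine smooth-curve datum -/

omit [IsTopologicalGroup P] in
/-- With no nodes, `Ker(Π_G ↠ Π^cpt_G) = Ker(Π_G ↠ Π^unr_G)` (both are the closed normal subgroup
generated by the cusp groups). [cite: MochizukiCombGC2007, Def 1.1(ii) p.7] -/
theorem cptKer_eq_unrKer_of_isEmpty [IsTopologicalGroup P] (G : PSCDatum P) [IsEmpty G.graph.N] :
    G.cptKer = G.unrKer := by
  unfold cptKer unrKer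
  rw [Set.iUnion_of_empty (fun e => (G.nodeGp e : Set P)), Set.union_empty]

/-- **[CombGC] Rmk. 1.1.6 HOLDS at a genuine smooth-curve datum.**  Let `G` be a PSC datum over the
profinite `Π` with no nodes, `Π_v = Π` for every vertex, one vertex `v₀`, a pro-`Σ` completion
`ι : Γ_{g,r} → Π` (`Σ = G.Sigma`), a bijection `e : cusps ≃ Fin r`, cusp groups conjugates of the
closed cusp inertia groups, and `genus(v) = g`; assume `G` sturdy (so `g ≥ 2`).  Then for every
presentation `f : Π ↠ Q` of `Π^cpt_G` (`Q` a Hausdorff topological group, `ker f = Ker(Π ↠ Π^cpt_G)`)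
the compactified datum `G' = G.compactifyAlong f` is a genuine smooth-curve datum of type `(g, 0)`:
`Q` is profinite, `G'` has no nodes and no cusps, one vertex with `Π'_v = Q`, genus `g`, `(g, 0)` is
hyperbolic, and `ῑ : Γ_{g,0} ≅ Γ_{g,r}/⟨⟨c_j⟩⟩ → Π/closure ι⟨⟨c_j⟩⟩ = Π/ker f ≅ Q` is a pro-`Σ`
completion. [cite: MochizukiCombGC2007, Rmk 1.1.6 p.8] -/
theorem compactifyAlong_smoothCurveGenuine [CompactSpace P] [TotallyDisconnectedSpace P]
    (G : PSCDatum P) [IsEmpty G.graph.N] (hV : ∀ v, G.vertGp v = ⊤) (v₀ : G.graph.V)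
    (hv : ∀ w, w = v₀) {g r : ℕ} (ι : PuncturedSurfaceGroup g r →* P)
    (hι : IsProSigmaCompletion G.Sigma ι) (e : G.graph.C ≃ Fin r)
    (hC : ∀ c, ∃ δ : ConjAct P,
      G.cuspGp c = δ • ((cuspInertia (g := g) (e c)).map ι).topologicalClosure)
    (hgen : ∀ v, G.genus v = g) (hst : G.IsSturdy)
    {Q : Type u} [Group Q] [TopologicalSpace Q] [IsTopologicalGroup Q] [T2Space Q]
    (f : P →* Q) (hf : Continuous f) (hs : Function.Surjective f) (hker : f.ker = G.cptKer) :
    CompactSpace Q ∧ TotallyDisconnectedSpace Q ∧ IsEmpty (G.compactifyAlong f hf hs).graph.N ∧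
      IsEmpty (G.compactifyAlong f hf hs).graph.C ∧ (∀ w, (G.compactifyAlong f hf hs).vertGp w = ⊤) ∧
      (∃ w₀ : (G.compactifyAlong f hf hs).graph.V, ∀ w, w = w₀) ∧ IsHyperbolicType g 0 ∧
      ∃ ι' : PuncturedSurfaceGroup g 0 →* Q,
        IsProSigmaCompletion (G.compactifyAlong f hf hs).Sigma ι' ∧
        ∀ w, (G.compactifyAlong f hf hs).genus w = g := by
  classical
  obtain ⟨hcQ, htQ, eQ, heQ⟩ := exists_quotientKer_continuousMulEquiv f hf hs
  -- the kernel is the closure of `ι(⟨⟨c_j⟩⟩)`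
  set N : Subgroup (PuncturedSurfaceGroup g r) :=
    Subgroup.normalClosure (⋃ j, (cuspInertia (g := g) (r := r) j : Set (PuncturedSurfaceGroup g r)))
    with hN
  have hKer : f.ker = ((N.map ι).topologicalClosure) := by
    rw [hker, G.cptKer_eq_unrKer_of_isEmpty, G.unrKer_eq_closure_map_of_smoothCurve' ι hι e hC]
  have hKcoe : (f.ker : Set P) = closure (ι '' (N : Set (PuncturedSurfaceGroup g r))) := by
    rw [hKer, Subgroup.topologicalClosure_coe, Subgroup.coe_map]
  -- `Γ_{g,r}/N → Π/ker f` is a pro-`Σ` completion, hence so is `Γ_{g,0} ≅ Γ_{g,r}/N → Π/ker f ≅ Q`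
  have hq := IsProSigmaCompletion.quotientMap_of_coe_eq_closure hι N f.ker hKcoe
  have hq' := hq.comp_continuousMulEquiv eQ
  obtain ⟨e₀⟩ := nonempty_mulEquiv_quotient_cusps g r
  let ι' : PuncturedSurfaceGroup g 0 →* Q :=
    ((eQ.toMulEquiv.toMonoidHom).comp (QuotientGroup.map N f.ker ι
      (IsProSigmaCompletion.le_comap_of_image_subset
        (IsProSigmaCompletion.image_subset_of_coe_eq_closure hKcoe)))).comp e₀.toMonoidHom
  have hι' : IsProSigmaCompletion G.Sigma ι' :=
    IsProSigmaCompletion.of_comp_mulEquiv e₀ (fun x => rfl) hq'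
  -- hyperbolicity of `(g, 0)` from sturdiness at the vertex `v₀`
  have hg : IsHyperbolicType g 0 := by
    have h2 : 2 ≤ g := (hgen v₀) ▸ hst v₀
    unfold IsHyperbolicType
    omega
  refine ⟨hcQ, htQ, inferInstanceAs (IsEmpty G.graph.N), inferInstanceAs (IsEmpty (Fin 0)),
    fun w => ?_, ⟨v₀, hv⟩, hg, ι', hι', fun w => hgen w⟩
  rw [compactifyAlong_vertGp, hV, Subgroup.map_top_of_surjective f hs]

/-! ### The origin-level statement at pro-`ℓ` genuine smooth-curve origins -/

/-- **`CompactifyOfPSCTypeHolds Ω` ([CombGC] Rmk. 1.1.6 as an origin-closure statement) HOLDS at every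
pro-`ℓ` genuine smooth-curve origin**: if the membership predicate of `Ω` is (in both directions) "PSC
datum over a profinite group with no nodes, `Π_v = Π` for all `v`, one vertex, `Σ = {ℓ}`, a pro-`Σ`
completion `ι : Γ_{g,r} → Π` of a hyperbolic punctured surface group, a bijection `e : cusps ≃ Fin r`,
`genus ≡ g`, cusp groups conjugates of `closure ι⟨c_{e c}⟩`" — verbatim the `let Ω` of
abc-iut-w5-d195's `exists_smoothCurveGenuineProLOrigin_holds` — then the compactification of every
sturdy `Ω`-datum along every presentation of its `Π^cpt` is an `Ω`-datum.
[cite: MochizukiCombGC2007, Rmk 1.1.6 p.8] -/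
theorem compactifyOfPSCTypeHolds_of_smoothCurveGenuine (ℓ : ℕ) (Ω : PSCOrigin.{u})
    (hout : ∀ ⦃Q : Type u⦄ [Group Q] [TopologicalSpace Q] (G : PSCDatum Q), Ω.IsOfPSCType G →
      ∃ (_ : IsTopologicalGroup Q), CompactSpace Q ∧ T2Space Q ∧
        TotallyDisconnectedSpace Q ∧ IsEmpty G.graph.N ∧ (∀ v, G.vertGp v = ⊤) ∧
        (∃ v₀ : G.graph.V, ∀ w, w = v₀) ∧ G.Sigma = {ℓ} ∧
        ∃ (g r : ℕ) (ι : PuncturedSurfaceGroup g r →* Q) (e : G.graph.C ≃ Fin r),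
          IsHyperbolicType g r ∧ IsProSigmaCompletion G.Sigma ι ∧ (∀ v, G.genus v = g) ∧
          ∀ c, ∃ δ : ConjAct Q, G.cuspGp c = δ • ((cuspInertia (g := g) (e c)).map ι).topologicalClosure)
    (hin : ∀ ⦃Q : Type u⦄ [Group Q] [TopologicalSpace Q] (G : PSCDatum Q),
      (∃ (_ : IsTopologicalGroup Q), CompactSpace Q ∧ T2Space Q ∧
        TotallyDisconnectedSpace Q ∧ IsEmpty G.graph.N ∧ (∀ v, G.vertGp v = ⊤) ∧
        (∃ v₀ : G.graph.V, ∀ w, w = v₀) ∧ G.Sigma = {ℓ} ∧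
        ∃ (g r : ℕ) (ι : PuncturedSurfaceGroup g r →* Q) (e : G.graph.C ≃ Fin r),
          IsHyperbolicType g r ∧ IsProSigmaCompletion G.Sigma ι ∧ (∀ v, G.genus v = g) ∧
          ∀ c, ∃ δ : ConjAct Q, G.cuspGp c =
            δ • ((cuspInertia (g := g) (e c)).map ι).topologicalClosure) → Ω.IsOfPSCType G) :
    CompactifyOfPSCTypeHolds Ω := by
  intro P _ _ _ _ Q _ _ _ _ G f hf hs hker hG hst
  obtain ⟨_, _, _, _, hN, hV, ⟨v₀, hv⟩, hSig, g, r, ι, e, _, hι, hgen, hC⟩ := hout G hG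
  haveI := hN
  obtain ⟨_, htQ, hN', hC', hV', hv', hg0, ι', hι', hgen'⟩ :=
    G.compactifyAlong_smoothCurveGenuine hV v₀ hv ι hι e hC hgen hst f hf hs hker
  refine hin _ ⟨inferInstance, inferInstance, inferInstance, htQ, hN', hV', hv', hSig, g, 0, ι',
    ⟨Equiv.equivOfIsEmpty _ _, hg0, hι', hgen', fun c => ?_⟩⟩
  exact (hC'.false c).elim

end PSCDatum

end Literature.AnabelianGeometry.SemiGraphs

end
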